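import Summits.QuantumFields.BalabanUV.Beta.GAN24.CombWilsonStepPush

/-!
# The (III′) cubic-Wilson LINEAGE of the comb-chart S-tower `ScombOf`, its remainder, and the lineage in units

NOT IN PRINT — OUR BOOKKEEPING (road-P2 = `b2b-balaban-gan24-p2` gen 55, 2026-08-25; row G-an2-4 ∕ (CONV-C), the (α-0) chain at row D1's literal
OF RECORD (III′) `JsB12CombShSym`; [our objects — bookkeeping, asserting nothing] TWO pointwise `def`s + [folklore] composition BY NAME; 0 cite, 0 `sorry`).
Weight 0.  NEVER «G-an2-4 closed» as (CONV-C); NOT D1, NOT BetaPertH, NOT continuum, NOT Clay; NO campaign opened (an2 W-4).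

This is the (III′) twin of leaf-03's (E) `GAN24/SrecWilsonSector` §1 ∕ §4: the abstract family of M.49 `CombWilsonStepPush` §3 gets its name.
* §1 `combWilsonAt Lc cE : ℕ → tables` — member `0` is `cE • wilsonA d`, member `j+1` is `(cE·wE (j+1)) • e3OfK Lc (GcombSh Lc j) (member j)` (the cubic line of
  `CombChartStepJets.ScombOf`'s recursion `RecursiveStencilSlot.SrecOf_succ` with the previous WILSON member in the table slot); `_zero ∕ _succ` by `rfl`;
  `isFF_combWilsonAt`, `locStencil_combWilsonAt` (M.49 §3 instantiated).
* §2 **`unitS_combWilsonAt_succ_eq_push₃`** — M.49 `unitS_combWilson_succ_eq_push₃` instantiated: `unitS_{k+1} (combWilsonAt Lc cE (k+1)) = (cE·c₃^{k+1}) • push₃ T′ T′ T′ (wilsonA d)`,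
  `T′ = legChain (fun j ↦ legComp ψ♭ R_j) 0 k` — leaf-03's `unitS_wilsonSecAt_succ_eq_push₃` with `R_j ↦ legComp ψ♭ R_j`.
* §3 the remainder `combBornOf tabs cE cVH cΛ j := ScombOf tabs cE cVH cΛ j − combWilsonAt Lc cE j`: `ScombOf = combWilsonAt + combBornOf`, member `0` = the border and Λ
  sectors of `S0NOf`, `locStencil_combBornOf`, and **`combBornOf_succ`** — the remainder obeys the DECOUPLED recursion (cubic line through `GcombSh Lc j` on the remainder only,
  sources `tabs.V` and the Λ-sector of `tabs.H`): leaf-01's `e3K_add` with `decays_GcombSh`.  So at (III′), as at (E), the Wilson lineage decouples from the rest.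
-/

open Finset
open scoped BigOperators
open Literature.MathematicalPhysics.QuantumFieldTheory
open Literature.MathematicalPhysics.QuantumFieldTheory.Balaban1983to89
open Literature.MathematicalPhysics.QuantumFieldTheory.Balaban1983to89.Beta
open ExpKernelCalculus (MKer Decays)
open AffineAveraging (Site box toSite)
open AveragingContoursRooted (ctr ctrOff ctrOff_mem_box)
open OneStepResolventKernel (Fib LocStencil)
open OneStepKernelFamily (KInvStep)
open BalabanStepJetsSucc (wE wVH wΛ E2 lamCoeffK)
open StepJetData (wilsonA locStencil_wilsonA locStencil_add locStencil_smul)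
open BalabanStepJets (locStencil_mono)
open InterLevelTransport (SLam)
open Summit.QuantumFields.BalabanUV.Beta.HessKerDressedUnits (unitS)
open Summit.QuantumFields.BalabanUV.Beta.GAN24.CombesThomas (sfStep smStep)
open Summit.QuantumFields.BalabanUV.Beta.GAN24.ThirdJetKernel (e3K)
open Summit.QuantumFields.BalabanUV.Beta.AxialDressingRooted (one_le_of_neZero)
open Summit.QuantumFields.BalabanUV.Beta.SpineRooted (e3OfK)
open Summit.QuantumFields.BalabanUV.Beta.GAN24.CubicReadoutDecLift (e3OfK_eq_e3K)
open Summit.QuantumFields.BalabanUV.Beta.GAN24.Push4 (legComp IsFF)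
open Summit.QuantumFields.BalabanUV.Beta.GAN24.Push4Iter (legChain)
open Summit.QuantumFields.BalabanUV.Beta.GAN24.Push3 (push₃)
open Summit.QuantumFields.BalabanUV.Beta.GAN24.RespStepBmDecompExact (respStepBmSeq)
open Summit.QuantumFields.BalabanUV.Beta.GAN24.SrecLinearPartEq (e3K_add)
open Summit.QuantumFields.BalabanUV.Beta.SymCorrectorKernel (psiKS)
open Summit.QuantumFields.BalabanUV.Beta.SymmetrisedStepJets (SymTables)
open OneStepResolventKernel (KInv)
open BalabanStepJets (lamCoeffOf)
open Summit.QuantumFields.BalabanUV.Beta.SpineRooted (S0NOf)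
open Summit.QuantumFields.BalabanUV.Beta.WardLocusRecursive (SrecOf SrecOf_zero SrecOf_succ)
open Summit.QuantumFields.BalabanUV.Beta.CombChartStepJets (GcombSh decays_GcombSh ScombOf locStencil_ScombOf)
open Summit.QuantumFields.BalabanUV.Beta.GAN24.CombWilsonStepPush (isFF_of_combWilsonRec locStencil_of_combWilsonRec unitS_combWilson_succ_eq_push₃)

namespace Summit.QuantumFields.BalabanUV.Beta.GAN24.CombWilsonSector

variable {d : ℕ}

/-! ## §1 The (III′) cubic-Wilson lineage -/

section Defs

variable (Lc : ℕ) [NeZero Lc]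

/-- [our object — bookkeeping, asserting nothing] **THE (III′) CUBIC-WILSON LINEAGE**: member `0` is `cE • wilsonA d` (the first summand of `S0NOf`), member `j+1` is
`(cE·wE (j+1)) • e3OfK Lc (GcombSh Lc j) (member j)` — the cubic line of `ScombOf`'s recursion with the previous WILSON member in the table slot (leaf-03's (E) `wilsonSecAt`
with the comb-chart resolvent `GcombSh Lc j` in place of `coDressKBmAt ρ Lc (KInvStep Lc j)`). -/
noncomputable def combWilsonAt (cE : ℝ) : ℕ → Fin (d + 1) → (Fin (d + 1) → ℤ) → MKer (d + 1) (Fib d)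
  | 0 => fun κ' u' => cE • wilsonA d κ' u'
  | j + 1 => fun κ' u' => (cE * wE d Lc (j + 1)) • e3OfK Lc (GcombSh (d := d) Lc j) (combWilsonAt cE j) κ' u'

/-- [folklore] Member `0`, by `rfl`. -/
@[simp] theorem combWilsonAt_zero (cE : ℝ) : combWilsonAt (d := d) Lc cE 0 = fun κ' u' => cE • wilsonA d κ' u' := rfl

/-- [folklore] The recursion step (unfolding lemma), by `rfl`. -/
theorem combWilsonAt_succ (cE : ℝ) (j : ℕ) :
    combWilsonAt (d := d) Lc cE (j + 1) = fun κ' u' => (cE * wE d Lc (j + 1)) • e3OfK Lc (GcombSh (d := d) Lc j) (combWilsonAt Lc cE j) κ' u' := rfl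

/-- [folklore] **EVERY MEMBER IS ff-VALUED** (M.49 `isFF_of_combWilsonRec`). -/
theorem isFF_combWilsonAt (cE : ℝ) (j : ℕ) (κ : Fin (d + 1)) (u : Fin (d + 1) → ℤ) : IsFF (combWilsonAt (d := d) Lc cE j κ u) :=
  isFF_of_combWilsonRec Lc cE (combWilsonAt_zero Lc cE) (combWilsonAt_succ Lc cE) j κ u

/-- [folklore] **EVERY MEMBER IS A LOCALISED STENCIL FAMILY** (M.49 `locStencil_of_combWilsonRec`). -/
theorem locStencil_combWilsonAt (cE : ℝ) (j : ℕ) : ∃ C δ : ℝ, 0 < δ ∧ LocStencil (combWilsonAt (d := d) Lc cE j) C δ :=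
  locStencil_of_combWilsonRec Lc cE (combWilsonAt_zero Lc cE) (combWilsonAt_succ Lc cE) j

end Defs

/-! ## §2 The lineage in the adopted units: one push of `wilsonA` through the conjugated dressed leg chains -/

section Units

variable (Lc : ℕ) [NeZero Lc]

/-- NOT IN PRINT; OUR BOOKKEEPING ([folklore]; M.49 `CombWilsonStepPush.unitS_combWilson_succ_eq_push₃` instantiated at the lineage — the (III′) twin of leaf-03's (E-α-W)
`SrecWilsonSector.unitS_wilsonSecAt_succ_eq_push₃`).  **THE (III′) CUBIC-WILSON LINEAGE, MEMBER `k+1`, IN THE ADOPTED UNITS, IS ONE THREE-LEG PUSH OF `wilsonA` THROUGH THE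
CONJUGATED DRESSED LEG CHAIN IN ALL THREE SLOTS**: `unitS (sfStep Lc (k+1)) (smStep d Lc (k+1)) (combWilsonAt Lc cE (k+1)) = fun κ′ u′ ↦ (cE·(cE·Lc^{2(d+1)})^{k+1}) • push₃ T′ T′ T′ (wilsonA d) κ′ u′`,
`T′ = legChain (fun j ↦ legComp ψ♭ R_j) 0 k`, `R_j = respStepBmSeq ρ_c Lc j`, `ψ♭ α x κ u = Ψ̂_S u x (inl κ) (inl α)` at `(ctrOff (d+1) Lc, Lc)`. -/
theorem unitS_combWilsonAt_succ_eq_push₃ (cE : ℝ) (k : ℕ) :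
    unitS (sfStep Lc (k + 1)) (smStep d Lc (k + 1)) (combWilsonAt (d := d) Lc cE (k + 1))
      = fun κ' u' => (cE * (cE * (Lc : ℝ) ^ (2 * (d + 1))) ^ (k + 1)) •
          push₃
            (legChain (fun j => legComp (fun α x κ u => psiKS (ctrOff (d + 1) Lc) Lc u x (Sum.inl κ) (Sum.inl α)) (respStepBmSeq (ctr (d + 1) Lc) Lc j)) 0 k)
            (legChain (fun j => legComp (fun α x κ u => psiKS (ctrOff (d + 1) Lc) Lc u x (Sum.inl κ) (Sum.inl α)) (respStepBmSeq (ctr (d + 1) Lc) Lc j)) 0 k)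
            (legChain (fun j => legComp (fun α x κ u => psiKS (ctrOff (d + 1) Lc) Lc u x (Sum.inl κ) (Sum.inl α)) (respStepBmSeq (ctr (d + 1) Lc) Lc j)) 0 k)
            (wilsonA d) κ' u' :=
  unitS_combWilson_succ_eq_push₃ Lc cE (combWilsonAt_zero Lc cE) (combWilsonAt_succ Lc cE) k

end Units

/-! ## §3 The remainder beside the lineage obeys the decoupled recursion -/

section Born

variable {Lc : ℕ} [NeZero Lc] (tabs : SymTables d Lc) (cE cVH cΛ : ℝ)

variable (Lc) in
/-- [our object — bookkeeping, asserting nothing] **THE REMAINDER OF THE COMB-CHART S-TOWER BESIDE ITS WILSON LINEAGE**: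
`combBornOf tabs cE cVH cΛ j := ScombOf tabs cE cVH cΛ j − combWilsonAt Lc cE j` (pointwise) — the sectors born from `tabs.V` and the Λ-sector of `tabs.H` at the levels `≤ j`
and pushed on through `GcombSh` (leaf-03's (E) `bornSecAt` at the comb chart). -/
noncomputable def combBornOf (j : ℕ) : Fin (d + 1) → (Fin (d + 1) → ℤ) → MKer (d + 1) (Fib d) :=
  fun κ' u' => ScombOf tabs cE cVH cΛ j κ' u' - combWilsonAt (d := d) Lc cE j κ' u'

/-- [folklore] **THE S-TOWER IS ITS WILSON LINEAGE PLUS THE REMAINDER** (by definition of the remainder). -/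
theorem ScombOf_eq_combWilsonAt_add_combBornOf (j : ℕ) :
    ScombOf tabs cE cVH cΛ j = fun κ' u' => combWilsonAt (d := d) Lc cE j κ' u' + combBornOf Lc tabs cE cVH cΛ j κ' u' := by
  funext κ' u'; simp only [combBornOf, add_sub_cancel]

/-- [folklore] Member `0` of the remainder: `S0NOf` with its `cE • wilsonA` summand removed — the border sector `cVH • tabs.V` plus the Λ-sector of `tabs.H`. -/
theorem combBornOf_zero :
    combBornOf Lc tabs cE cVH cΛ 0 = fun κ' u' =>
      cVH • tabs.V κ' u' + cΛ • SLam Lc (lamCoeffOf (KInv (N := Lc) (d := d)) Lc) tabs.H κ' u' := by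
  funext κ' u'
  show SrecOf d Lc tabs.V tabs.H (GcombSh (d := d) Lc) cE cVH cΛ 0 κ' u' - cE • wilsonA d κ' u' = _
  rw [SrecOf_zero]
  show cE • wilsonA d κ' u' + cVH • tabs.V κ' u' + cΛ • SLam Lc (lamCoeffOf (KInv (N := Lc) (d := d)) Lc) tabs.H κ' u' - cE • wilsonA d κ' u' = _
  abel

/-- [folklore] The remainder is a localised stencil family: `ScombOf` (`CombChartStepJets.locStencil_ScombOf`) minus the lineage (`locStencil_combWilsonAt`). -/
theorem locStencil_combBornOf (j : ℕ) : ∃ Cs δ : ℝ, 0 < δ ∧ LocStencil (combBornOf Lc tabs cE cVH cΛ j) Cs δ := by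
  obtain ⟨Cs, δs, hδs, hS⟩ := locStencil_ScombOf tabs cE cVH cΛ j
  obtain ⟨Cw, δw, hδw, hW⟩ := locStencil_combWilsonAt (d := d) Lc cE j
  have hCs : 0 ≤ Cs := (hS 0 0).nonneg (Sum.inl 0)
  have hCw : 0 ≤ Cw := (hW 0 0).nonneg (Sum.inl 0)
  refine ⟨Cs + |(-1 : ℝ)| * Cw, min δs δw, lt_min hδs hδw, ?_⟩
  have h := locStencil_add (locStencil_mono hS hCs (min_le_left δs δw)) (locStencil_smul (-1) (locStencil_mono hW hCw (min_le_right δs δw)))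
  refine fun κ' u' => ?_
  have e : combBornOf Lc tabs cE cVH cΛ j κ' u' = ScombOf tabs cE cVH cΛ j κ' u' + (-1 : ℝ) • combWilsonAt (d := d) Lc cE j κ' u' := by
    simp only [combBornOf, neg_one_smul, sub_eq_add_neg]
  rw [e]
  exact h κ' u'

/-- NOT IN PRINT; OUR BOOKKEEPING ([folklore]; the (III′) twin of leaf-03's `SrecWilsonSector.bornSecAt_succ`).
**THE REMAINDER OBEYS THE DECOUPLED RECURSION — ITS CUBIC LINE READS THE REMAINDER ONLY, THE SOURCES ARE THE FRESH BORDER AND Λ SECTORS OF THE SYM TABLES**: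
`combBornOf (j+1) = (cE·wE (j+1)) • e3OfK Lc (GcombSh Lc j) (combBornOf j) + (cVH·wVH (j+1)) • tabs.V + (cΛ·wΛ (j+1)) • SLam Lc (lamCoeffK K_{j+1} E2_{j+1} Lc) tabs.H`
(`RecursiveStencilSlot.SrecOf_succ` minus `combWilsonAt_succ`, the cubic functional being ADDITIVE on localised families: leaf-01's `e3K_add` with `decays_GcombSh`,
`locStencil_combWilsonAt`, `locStencil_combBornOf`).  So at (III′), as at (E), the Wilson lineage DECOUPLES from the rest of the S-recursion. -/
theorem combBornOf_succ (j : ℕ) :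
    combBornOf Lc tabs cE cVH cΛ (j + 1) = fun κ' u' =>
      (cE * wE d Lc (j + 1)) • e3OfK Lc (GcombSh (d := d) Lc j) (combBornOf Lc tabs cE cVH cΛ j) κ' u' +
        (cVH * wVH d Lc (j + 1)) • tabs.V κ' u' +
        (cΛ * wΛ d Lc (j + 1)) • SLam Lc (lamCoeffK (KInvStep (d := d) Lc (j + 1)) (E2 d Lc (j + 1)) Lc) tabs.H κ' u' := by
  obtain ⟨δG, CG, hδG, -, hG⟩ := decays_GcombSh (d := d) Lc j
  obtain ⟨Cw, δw, hδw, hW⟩ := locStencil_combWilsonAt (d := d) Lc cE j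
  obtain ⟨Cb, δb, hδb, hB⟩ := locStencil_combBornOf tabs cE cVH cΛ j
  -- the cubic functional of member `j` splits along `ScombOf j = combWilsonAt j + combBornOf j`
  have hsplit : ∀ κ' u', e3OfK Lc (GcombSh (d := d) Lc j) (ScombOf tabs cE cVH cΛ j) κ' u'
      = e3OfK Lc (GcombSh (d := d) Lc j) (combWilsonAt (d := d) Lc cE j) κ' u'
        + e3OfK Lc (GcombSh (d := d) Lc j) (combBornOf Lc tabs cE cVH cΛ j) κ' u' := by
    intro κ' u'
    rw [ScombOf_eq_combWilsonAt_add_combBornOf, e3OfK_eq_e3K, e3OfK_eq_e3K, e3OfK_eq_e3K]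
    exact e3K_add hG hδG Lc hW hB hδw hδb κ' u'
  funext κ' u'
  show ScombOf tabs cE cVH cΛ (j + 1) κ' u' - combWilsonAt (d := d) Lc cE (j + 1) κ' u' = _
  rw [combWilsonAt_succ]
  show SrecOf d Lc tabs.V tabs.H (GcombSh (d := d) Lc) cE cVH cΛ (j + 1) κ' u' - _ = _
  rw [SrecOf_succ]
  show (cE * wE d Lc (j + 1)) • e3OfK Lc (GcombSh (d := d) Lc j) (ScombOf tabs cE cVH cΛ j) κ' u' +
        (cVH * wVH d Lc (j + 1)) • tabs.V κ' u' +
        (cΛ * wΛ d Lc (j + 1)) • SLam Lc (lamCoeffK (KInvStep (d := d) Lc (j + 1)) (E2 d Lc (j + 1)) Lc) tabs.H κ' u'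
      - (cE * wE d Lc (j + 1)) • e3OfK Lc (GcombSh (d := d) Lc j) (combWilsonAt (d := d) Lc cE j) κ' u' = _
  rw [hsplit κ' u', smul_add]
  abel

end Born

end Summit.QuantumFields.BalabanUV.Beta.GAN24.CombWilsonSector
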